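/-
Copyright (c) 2026 the pub-hodgecm-mathlib formalisation cell (harness21).  Track B «K2-LIT» prover seat hodgecm-mathlib-K2E3-p21 (g0); first follow-on helper of row #21
(`sig_K2E3EPFunctionGWild`, ★ p854998): the guard-free place junction of Kottwitz's EP function on `U(Φ₃)(L⁺_v)`.  2026-09-03.
-/
import Summits.HodgeConjecture.HodgeConjecture.Theorems.K2E3EPFunctionGWild          -- ★ p854998 (this seat): `epFunctionGWild` — (G3) at a WILD place (`e(w|v) ≠ 1`, `|2|_w < 1`)
import Summits.HodgeConjecture.HodgeConjecture.Theorems.F0P3cStCharTSEPGlueGNotWild   -- ★ p853093 (F0P3a-p09): `exists_epFunction_G_of_ramificationIdx'_or_valued_two` (the NOT-WILD junction; brings ★ (G3) inert and ★ (G3)-RAM tame)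
import HarnessLib

/-!
# K2 · E3 · U5-a follow-on — file `K2E3EPFunctionGNonsplit`: KOTTWITZ'S EULER–POINCARÉ FUNCTION ON `G_v = U(Φ₃)(L⁺_v)` AT EVERY NON-SPLIT FINITE PLACE, NO GUARD
# [Kottwitz1988 §2 Thm. 2; Rogawski1990 §12.6 p. 187; Tits1979 §2.4, §2.7]

Cell `pub/hodgecm-mathlib` (D-0151), Track B «K2-LIT», crux H413 = `stmt-HodgeConjecture-24833` (lane `--kind proof --supports … --as helper`), route of record
`HCCMUnconditional`; seat K2E3-p21 (g0).  THEOREMS ONLY (no definition ∕ instance ∕ notation ∕ named fact ∕ `sorry`); ★-only imports (never a `Cruxes/…/Lines` module).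

WHAT.  The PLACE JUNCTION WITHOUT A GUARD: for a CM field `L` and a finite place `v` of `L⁺` that is NON-SPLIT in `L` — inert, tamely ramified OR wildly (dyadic) ramified, no
further hypothesis — every Haar measure `νQv` on `G_v = U(Φ₃)(L⁺_v)` and every family `mQv` canonical for (`IsRegularElt`, `νQv`) admit Kottwitz's Euler–Poincaré function
`f_G` with the EIGHT clauses of ★ (G3) `exists_epFunction_G` VERBATIM (locally constant compactly supported, measurable, integrable, mass one, `f_G(1)` real negative, canonical
orbital integral `1` at regular classes with compact centraliser and `0` at regular classes with non-compact centraliser).  This is the name a rider cites to DROP the EP-family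
guard «`v` unramified in `L` ∨ `|2|_v = 1`» of ★ `exists_epFunction_G_of_not_wild` (census G-RAM §4 «WILD∕dyadic ramified places stay OPEN» is closed by ★ p854998).

HOW.  Pure case split, no new mathematics: at the place `w ∣ v` (unique, ★ `hns`), `|2|_w = 1` ⇒ ★ NOT-WILD junction `exists_epFunction_G_of_ramificationIdx'_or_valued_two`
(`Or.inr`); else `e(w|v) = 1` ⇒ the same junction (`Or.inl`); else `e(w|v) ≠ 1` and `|2|_w < 1` (`|2|_w ≤ 1` always: `2 = 1 + 1`) ⇒ ★ WILD `K2E3EPFunctionGWild.epFunctionGWild`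
(p854998, socket #21 of the E3 sigs table, over Track A's wild tree U0).

* §1 **`exists_epFunction_G_of_placesOver`** — the junction with the place `w ∣ v` as a binder and NO hypothesis on `w`.
* §2 **`exists_epFunction_G_of_nonsplit`** — the junction in `L⁺_v`-letters: `v` non-split, nothing else.
HONEST LABEL: count-neutral helper (`--supports 24833 --as helper`); it closes no organ node by itself — it makes the (G3) input of ★ (G4)∕(G5)∕«EP-SPLIT» (e.g. ★
`F0P3cStCharTSEPPseudoCoeffStLetters.exists_isPseudoCoeff_stG_of_epFunction`, POS-ONE at `St_G(ψ)`) available at EVERY non-split place; h413 OPEN; HC_CM is proved only modulo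
the 7 printed citations (2 remaining named inputs: hLiu418 = `stmt-HodgeConjecture-24832`, h413 = `stmt-HodgeConjecture-24833`) until rung 0 closes.

## References
* [Kottwitz1988] R. E. Kottwitz, *Tamagawa numbers*, Ann. of Math. 127 (1988), §2 Theorem 2 (Euler–Poincaré functions on a `p`-adic reductive group; no tameness hypothesis).
* [Rogawski1990] J. D. Rogawski, *Automorphic Representations of Unitary Groups in Three Variables* (1990), §12.6 p. 187 (pseudo-coefficients).
* [Tits1979] J. Tits, *Reductive groups over local fields*, PSPM 33.1 (1979), §2.4, §2.7 (local indices of `²A₂`: `(q³+1, q+1)` unramified, `(q+1, q+1)` ramified).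
-/

set_option autoImplicit false
-- the mandated namespace has the single-problem summit's repeated segment (`HodgeConjecture.HodgeConjecture`)
set_option linter.dupNamespace false

noncomputable section

open NumberField IsDedekindDomain MeasureTheory Topology
open scoped Matrix MatrixGroups Valued
open Literature.NumberTheory.Rogawski1990 Literature.NumberTheory.Automorphic Literature.NumberTheory.Automorphic.UnitaryGroup
open Literature.NumberTheory.GaloisRepresentations
open Summit.HodgeConjecture.HodgeConjecture.Cruxes.H413.F0P3cStCharTSEPGlueGNotWild
open Summit.HodgeConjecture.HodgeConjecture.Cruxes.H413.K2E3EPFunctionGWild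

namespace Summit.HodgeConjecture.HodgeConjecture.Cruxes.H413.K2E3EPFunctionGNonsplit

variable (L : Type) [Field L] [NumberField L] [IsCMField L] (v : HeightOneSpectrum (𝓞 ↥(maximalRealSubfield L)))

/-! ## §1 The junction with the place `w ∣ v` as a binder, no hypothesis on `w` -/

set_option maxHeartbeats 1600000 in  -- statement-level `whnf` on the CM carriers + eight clauses, the budget line of ★ (G3) `exists_epFunction_G` :152 and of ★ NOT-WILD §1 (measured there)
/-- **(G3) AT ANY `w ∣ v`, NO GUARD**: Kottwitz's Euler–Poincaré function on `G_v = U(Φ₃)(L⁺_v)` (`v` non-split) exists — the eight clauses of ★ (G3) `exists_epFunction_G`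
VERBATIM — whatever the place `w` of `L` above `v` is: `|2|_w = 1` or `e(w|v) = 1` ⇒ ★ NOT-WILD `exists_epFunction_G_of_ramificationIdx'_or_valued_two`; `e(w|v) ≠ 1` and
`|2|_w < 1` ⇒ ★ WILD `epFunctionGWild` (p854998). [cite: Kottwitz1988, §2 Theorem 2] [cite: Rogawski1990, §12.6 p. 187] [cite: Tits1979, §2.4, §2.7] -/
theorem exists_epFunction_G_of_placesOver (hns : ∀ w : PlacesOver L v, IsCMField.complexConj L • w.1 = w.1) (w : PlacesOver L v)
    [MeasurableSpace (Gqs L v)] [BorelSpace (Gqs L v)]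
    [∀ γ : Gqs L v, MeasurableSpace (Gqs L v ⧸ Subgroup.centralizer ({γ} : Set (Gqs L v)))]
    [∀ γ : Gqs L v, BorelSpace (Gqs L v ⧸ Subgroup.centralizer ({γ} : Set (Gqs L v)))]
    (νQv : Measure (Gqs L v)) [νQv.IsHaarMeasure] [νQv.IsMulRightInvariant]
    {mQv : OrbitalMeasureFamily (Gqs L v)}
    (hcanQ : mQv.IsCanonical (fun γ => IsRegularElt (γ.val : GL (Fin 3) (UnitaryGroup.LocalRing L v))) νQv) :
    ∃ fG : Gqs L v → ℂ, IsLocSmooth fG ∧ Measurable fG ∧ Integrable fG νQv ∧ ∫ g, fG g ∂νQv = 1 ∧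
      (fG 1).im = 0 ∧ (fG 1).re < 0 ∧
      (∀ γ : Gqs L v, IsRegularElt (γ.val : GL (Fin 3) (UnitaryGroup.LocalRing L v)) →
        IsCompact ((Subgroup.centralizer ({γ} : Set (Gqs L v))) : Set (Gqs L v)) → classOrbitalIntegral mQv fG (ConjClasses.mk γ) = 1) ∧
      (∀ γ : Gqs L v, IsRegularElt (γ.val : GL (Fin 3) (UnitaryGroup.LocalRing L v)) →
        ¬ IsCompact ((Subgroup.centralizer ({γ} : Set (Gqs L v))) : Set (Gqs L v)) → classOrbitalIntegral mQv fG (ConjClasses.mk γ) = 0) := by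
  by_cases h2 : Valued.v (2 : w.1.adicCompletion L) = 1
  · exact exists_epFunction_G_of_ramificationIdx'_or_valued_two L v hns w (Or.inr h2) νQv hcanQ
  · by_cases he : v.asIdeal.ramificationIdx' w.1.asIdeal = 1
    · exact exists_epFunction_G_of_ramificationIdx'_or_valued_two L v hns w (Or.inl he) νQv hcanQ
    · -- the wild case: `|2|_w ≤ 1` always (`2 = 1 + 1`), hence `|2|_w < 1`
      have hle : Valued.v (2 : w.1.adicCompletion L) ≤ 1 := by
        rw [show (2 : w.1.adicCompletion L) = 1 + 1 by norm_num]
        exact (Valuation.map_add _ _ _).trans (by rw [map_one, max_self])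
      exact epFunctionGWild L v hns w he (lt_of_le_of_ne hle h2) νQv mQv hcanQ

/-! ## §2 The junction in `L⁺_v`-letters: `v` non-split, nothing else -/

set_option maxHeartbeats 1600000 in  -- statement-level `whnf` on the CM carriers + eight clauses, exactly as ★ (G3) `exists_epFunction_G` :152 (measured there)
/-- **(G3)-NONSPLIT — KOTTWITZ'S EULER–POINCARÉ FUNCTION ON `G_v = U(Φ₃)(L⁺_v)` AT EVERY NON-SPLIT FINITE PLACE, NO GUARD** (inert, tamely or wildly ramified alike): there is
`f_G : G_v → ℂ`, locally constant with compact support, measurable, integrable, with `∫ f_G dνQv = 1`, `f_G(1)` REAL NEGATIVE, canonical orbital integral `1` at every regular class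
with COMPACT centraliser and `0` at every regular class with NON-compact centraliser — the eight clauses of ★ (G3) `exists_epFunction_G` VERBATIM, so every (G3) consumer
((G4) ELL-MASS-G, (G5) pseudo-coefficients ∕ POS-ONE at `St_G(ψ)`, the riders' «EP-SPLIT») `obtain`s it unchanged and may DROP the guard «unramified ∨ `|2|_v = 1`» of ★
`exists_epFunction_G_of_not_wild`.  (★ §1 at the place `w ∣ v`, which exists: `PlacesOver L v` is non-empty.)
[cite: Kottwitz1988, §2 Theorem 2] [cite: Rogawski1990, §12.6 p. 187] [cite: Tits1979, §2.4, §2.7] -/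
theorem exists_epFunction_G_of_nonsplit (hns : ∀ w : PlacesOver L v, IsCMField.complexConj L • w.1 = w.1)
    [MeasurableSpace (Gqs L v)] [BorelSpace (Gqs L v)]
    [∀ γ : Gqs L v, MeasurableSpace (Gqs L v ⧸ Subgroup.centralizer ({γ} : Set (Gqs L v)))]
    [∀ γ : Gqs L v, BorelSpace (Gqs L v ⧸ Subgroup.centralizer ({γ} : Set (Gqs L v)))]
    (νQv : Measure (Gqs L v)) [νQv.IsHaarMeasure] [νQv.IsMulRightInvariant]
    {mQv : OrbitalMeasureFamily (Gqs L v)}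
    (hcanQ : mQv.IsCanonical (fun γ => IsRegularElt (γ.val : GL (Fin 3) (UnitaryGroup.LocalRing L v))) νQv) :
    ∃ fG : Gqs L v → ℂ, IsLocSmooth fG ∧ Measurable fG ∧ Integrable fG νQv ∧ ∫ g, fG g ∂νQv = 1 ∧
      (fG 1).im = 0 ∧ (fG 1).re < 0 ∧
      (∀ γ : Gqs L v, IsRegularElt (γ.val : GL (Fin 3) (UnitaryGroup.LocalRing L v)) →
        IsCompact ((Subgroup.centralizer ({γ} : Set (Gqs L v))) : Set (Gqs L v)) → classOrbitalIntegral mQv fG (ConjClasses.mk γ) = 1) ∧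
      (∀ γ : Gqs L v, IsRegularElt (γ.val : GL (Fin 3) (UnitaryGroup.LocalRing L v)) →
        ¬ IsCompact ((Subgroup.centralizer ({γ} : Set (Gqs L v))) : Set (Gqs L v)) → classOrbitalIntegral mQv fG (ConjClasses.mk γ) = 0) := by
  obtain ⟨w⟩ : Nonempty (PlacesOver L v) := inferInstance
  exact exists_epFunction_G_of_placesOver L v hns w νQv hcanQ

end Summit.HodgeConjecture.HodgeConjecture.Cruxes.H413.K2E3EPFunctionGNonsplit

end
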